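import Mathlib
import Summits.Ventures.HodgeRepro.PeriodCloserC7IdentificationChain
import Summits.Ventures.HodgeRepro.PeriodCloserC7LineClasses

/-!
# PeriodCloserC7Refined — the closer C7 in its most refined kernel form: components of the identification + (E2)
discharged by reciprocity

Blind re-derivation cell `pub-hodge-repro`, seat night-2 (gen 3).  Target tree path
`lean/Summits/Ventures/HodgeRepro/PeriodCloserC7Refined.lean`.  Composes gen 2's refinement of the ONE unprinted
identification (`PeriodCloserC7IdentificationChain.lean`: `ChainHypothesesRefined`, `S4face_of_components`) with
gen 3's discharge of the route-derived (E2) clause (`PeriodCloserC7LineClasses.lean`: `ChainHypothesesFree`,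
`S4face_of_chain_free`).

`ChainHypothesesRefinedFree C` is gen 0's `ChainHypothesesAdm I` with BOTH replacements made: `ident` → the component
interfaces `D`, `S` with their bundles (D0)–(D4), (S1)–(S3) (each a `def … : Prop` with its printed shape cited in
`PeriodCloserC7Identification.lean`), and `discharge : LocalDischarge I` → `LocalDischargeFree I` (the (E1), (E3), (E5)
clauses only; (E2) from (R1) is the theorem `E2_withClasses_of_R1` over the line-class interface `C`).  The closer is
`S4face_of_components_free (C) (H : ChainHypothesesRefinedFree C) : I.S4face`.

WHAT AN INTERFACE THEOREM IS: exactly as strong as the logical chain it encodes; every automorphic object is a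
parameter; the free choice of the line classes and TP1's definition of the local condition are fields of `C`; the
normalisation matches of the components stay unprinted as gen 2 lists them.  No statement of ROUTE.md (S4, S4 on the
faces, (P)) is closed.  Nothing here says anything about the status of the Hodge conjecture for CM abelian varieties,
which is NOT proved.
-/

set_option autoImplicit false

noncomputable section

namespace Summit.Ventures.HodgeRepro.PeriodCloser

open NumberField

variable {L : Type} [Field L] [NumberField L] [IsCMField L]

/-- **The hypotheses of the chain, refined on both sides**: the identification through its components (gen 2) and
the local discharge without its (E2) clause (gen 3), over a line-class interface `C`. -/
structure ChainHypothesesRefinedFree {I : C7Face L} {D : NormResidueData I.Place}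
    (C : LineClassInterface I D) where
  /-- the doubling interface -/
  Dbl : DoublingInterface I
  /-- the components (D0)–(D4) of the doubling form -/
  hD : DoublingComponents I Dbl
  /-- the spectral interface -/
  Sp : SpectralInterface I
  /-- the components (S1)–(S3) of the seesaw form -/
  hS : SeesawComponents I Sp
  /-- Lemma Π -/
  lemmaPi : LemmaPi I
  /-- the witness `Y = f(X)` -/
  witness : PeriodWitness I
  /-- Borade et al. 2025 Thm 1.4 -/
  tp1 : Borade2025_Thm1_4 I
  /-- BHTY 2025 Thm 1.1 -/
  bhty : BHTY2025_Thm1_1 I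
  /-- BHTY 2025 Lemma 4.11, split case -/
  bhtySplit : BHTY2025_Lemma4_11_split I
  /-- `Ξ_𝔭` infinite; split ⟹ unramified -/
  xi : XiInfinite I
  /-- Tate's product formula -/
  productFormula : ProductFormula I
  /-- the sign flip of ROUTE-B §9.10, on admissible data -/
  flipAdm : FlipRootNumberAdm I
  /-- the local discharge without its (E2) clause -/
  dischargeFree : LocalDischargeFree I
  /-- the admissible family -/
  family : AdmissibleFamily I

/-- The doubly refined bundle gives gen 3's free bundle (the identification composed from its components). -/
theorem ChainHypothesesRefinedFree.toFree {I : C7Face L} {D : NormResidueData I.Place}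
    (C : LineClassInterface I D) (H : ChainHypothesesRefinedFree C) : ChainHypothesesFree C :=
  ⟨identification_of_components I H.Dbl H.Sp H.hD H.hS, H.lemmaPi, H.witness, H.tp1, H.bhty, H.bhtySplit, H.xi,
    H.productFormula, H.flipAdm, H.dischargeFree, H.family⟩

/-- Gen 2's refined bundle gives the doubly refined one over any line-class interface (drop the (E2) clause). -/
def ChainHypothesesRefined.toRefinedFree {I : C7Face L} {D : NormResidueData I.Place}
    (C : LineClassInterface I D) (H : ChainHypothesesRefined I) : ChainHypothesesRefinedFree C :=
  ⟨H.D, H.hD, H.S, H.hS, H.lemmaPi, H.witness, H.tp1, H.bhty, H.bhtySplit, H.xi, H.productFormula, H.flipAdm,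
    H.discharge.toFree, H.family⟩

/-- **THE CLOSER C7, MOST REFINED FORM**: S4 for the face from the components (D0)–(D4), (S1)–(S3) of the
identification, the printed theorems (Borade et al. 2025 Thm 1.4; BHTY 2025 Thm 1.1 / Lemma 4.11; Tate's product
formula), the route-derived steps (Lemma Π, the witness, the §9.10 flip, (E1)/(E3)/(E5) on admissible data, the
admissible family) and the line-class interface — (E2) being chosen by reciprocity on the kernel. -/
theorem S4face_of_components_free {I : C7Face L} {D : NormResidueData I.Place} (C : LineClassInterface I D)
    (H : ChainHypothesesRefinedFree C) : I.S4face :=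
  S4face_of_chain_free C (ChainHypothesesRefinedFree.toFree C H)

/-- Gen 2's closer is the special case. -/
theorem S4face_of_components_of_refinedFree {I : C7Face L} {D : NormResidueData I.Place}
    (C : LineClassInterface I D) (H : ChainHypothesesRefined I) : I.S4face :=
  S4face_of_components_free C (ChainHypothesesRefined.toRefinedFree C H)

end Summit.Ventures.HodgeRepro.PeriodCloser

end
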